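import Mathlib.Algebra.BigOperators.Group.Finset.Powerset
import Mathlib.Algebra.Order.BigOperators.Group.Finset
import Mathlib.Order.UpperLower.Basic
import Mathlib.Tactic
import HarnessLib

/-!
# `NoHeavyLowerTail` (crux stmt-CriticalPhenomena-4575), abstract sunflower cubic: the ANTIPODAL (counting) form of Gladkov's
# strong Harris–Kleitman inequality for a monotone map to the diamond `M₃`, with offsets (polarised form)

Support file (seat `prim-ineq-prove-1` gen 25; `--supports stmt-CriticalPhenomena-4575`).  Nothing is asserted about the crux; no `sorry`.
Memo: run/shared/lean/prim/prim-ineq-prove-1/ABSTRACT-SUNFLOWER-CUBIC-prove1-g25.md §4(a).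

SETTING.  Three up-sets `V 0, V 1, V 2 ⊆ 2^α` with ALL pairwise intersections equal (`Sunflower`); equivalently a monotone map
`lab : 2^α → M₃` to the diamond lattice (`0` bottom, `1,2,3` petals, `4` top = the common intersection), `Sunflower.lab_mono`.
The percolation instances are the two three-point sunflowers (`{j ~ k}_i`, `{i isolated}_i`) and the four-point PAIRING sunflower behind
the E3GRP class `γ` (memo §1).  The Gladkov kernel `kk` is `+1` on {top, bottom} pairs, `−1` on pairs of DISTINCT petals, `0` otherwise;
it is submodular on comparable rectangles of `M₃` (`kk_submod`, `decide`) and nonnegative on comparable pairs (`kk_nonneg_of_mle`).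

THEOREM (`antipodal_sum_nonneg`; this work, five-line induction): for every finite `W` and offsets `G₂ ⊆ G₁`,
  `0 ≤ Σ_{S ⊆ W} kk (lab (G₁ ∪ S)) (lab (G₂ ∪ (W ∖ S)))`.
Step: expose `e ∈ W`; the two terms with `e` on either side are `kk s⁰ t¹ + kk s¹ t⁰ ≥ kk s⁰ t⁰ + kk s¹ t¹` pointwise (`kk_submod`,
monotonicity of `lab`), and the right-hand side regroups into the two instances of the claim on `W ∖ e` with offsets `(G₁, G₂)` and
`(insert e G₁, insert e G₂)`; base `kk (lab G₁) (lab G₂) ≥ 0` because `lab G₂ ≤ lab G₁`.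
COROLLARIES: `antipodal_gladkov` (`G₁ = G₂ = ∅`): on every sub-cube `2^W` the number of antipodal pairs `(S, W∖S)` labelled by two
DISTINCT petals is at most the number labelled {top, bottom} (`card_distinctPetals_le`) — the two-copy fibre (tensor-Bernstein) form
of Gladkov's `ab ≥ e₂(c)` for `M₃`-valued maps, the counting analogue of `prodBernoulli_strongHarris_sunflower_three`; and its
POLARISED form for the comparable pair of sections `lab (G₁ ∪ ·) ≥ lab (G₂ ∪ ·)`.  This is the proved half "(a)" of the partition
lemma of the memo (§4): summing `antipodal_gladkov` over a kernel spectator block gives `N(A,A,B) ≥ Σ_{i<j} N(C_i,C_j,A)`.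
-/

namespace Summit.CriticalPhenomena.PercolationContinuityZ3.Theorems.SunflowerPartition

open Finset

/-! ## The diamond `M₃` on `Fin 5` and the Gladkov kernel -/

/-! The order of the diamond `M₃` coded on `Fin 5` (`0` bottom, `4` top, `1,2,3` pairwise incomparable petals) is written out as the
disjunction `a = b ∨ a = 0 ∨ b = 4` throughout (no `Prop`-valued definition). -/

/-- The antipodal Gladkov kernel: `+1` on {top, bottom}, `−1` on two distinct petals, `0` otherwise. [this work] -/
def kk (a b : Fin 5) : ℤ :=
  if (a = 4 ∧ b = 0) ∨ (a = 0 ∧ b = 4) then 1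
  else if a ≠ 0 ∧ a ≠ 4 ∧ b ≠ 0 ∧ b ≠ 4 ∧ a ≠ b then -1 else 0

/-- Submodularity of `kk` on comparable rectangles of `M₃`. [this work] -/
theorem kk_submod : ∀ s0 s1 t0 t1 : Fin 5, (s0 = s1 ∨ s0 = 0 ∨ s1 = 4) → (t0 = t1 ∨ t0 = 0 ∨ t1 = 4) →
      kk s0 t0 + kk s1 t1 ≤ kk s1 t0 + kk s0 t1 := by
  decide

/-- `kk` is nonnegative on comparable pairs. [this work] -/
theorem kk_nonneg_of_mle : ∀ a b : Fin 5, (b = a ∨ b = 0 ∨ a = 4) → 0 ≤ kk a b := by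
  decide

/-- `kk` as a signed combination of indicators. [this work] -/
theorem kk_eq_ite (a b : Fin 5) :
    kk a b = (if a = 4 ∧ b = 0 then 1 else 0) + (if a = 0 ∧ b = 4 then 1 else 0)
      - (if a ≠ 0 ∧ a ≠ 4 ∧ b ≠ 0 ∧ b ≠ 4 ∧ a ≠ b then 1 else 0) := by
  revert a b; decide

/-! ## Three up-sets with common pairwise intersections = a monotone map to `M₃` -/

variable {α : Type*} [DecidableEq α]

/-- Three up-sets of `2^α` all of whose pairwise intersections coincide (a "sunflower of up-sets"; equivalently a monotone map
`2^α → M₃`). [this work] -/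
structure Sunflower (α : Type*) [DecidableEq α] where
  /-- the three up-sets `V i = A ⊔ C_i` -/
  V : Fin 3 → Finset (Finset α)
  /-- each `V i` is an up-set -/
  upper : ∀ i, IsUpperSet (V i : Set (Finset α))
  /-- all pairwise intersections equal `V 0 ∩ V 1` -/
  inter_eq : ∀ i j, i ≠ j → V i ∩ V j = V 0 ∩ V 1

namespace Sunflower

variable (F : Sunflower α)

/-- The kernel `A` (top cell). [this work] -/
def A : Finset (Finset α) := F.V 0 ∩ F.V 1

/-- The `M₃`-valued labelling: `4` on the kernel, `i+1` on the petal `V i ∖ A`, `0` elsewhere. [this work] -/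
def lab (S : Finset α) : Fin 5 :=
  if S ∈ F.A then 4 else if S ∈ F.V 0 then 1 else if S ∈ F.V 1 then 2 else if S ∈ F.V 2 then 3 else 0

/-- A set in two different `V i` lies in the kernel. [this work] -/
theorem mem_A_of_mem_mem {S : Finset α} {i j : Fin 3} (hij : i ≠ j) (hi : S ∈ F.V i) (hj : S ∈ F.V j) : S ∈ F.A := by
  have h : S ∈ F.V i ∩ F.V j := mem_inter.2 ⟨hi, hj⟩
  rw [F.inter_eq i j hij] at h
  exact h

/-- `V i` is an up-set (restated). [this work] -/
theorem mem_V_of_subset {S T : Finset α} {i : Fin 3} (hST : S ⊆ T) (h : S ∈ F.V i) : T ∈ F.V i :=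
  F.upper i hST h

/-- The kernel is an up-set. [this work] -/
theorem mem_A_of_subset {S T : Finset α} (hST : S ⊆ T) (h : S ∈ F.A) : T ∈ F.A := by
  unfold A at *
  rw [mem_inter] at *
  exact ⟨F.mem_V_of_subset hST h.1, F.mem_V_of_subset hST h.2⟩

/-- **Monotonicity of the labelling** into the diamond order. [this work] -/
theorem lab_mono {S T : Finset α} (hST : S ⊆ T) : F.lab S = F.lab T ∨ F.lab S = 0 ∨ F.lab T = 4 := by
  unfold lab
  by_cases hSA : S ∈ F.A
  · have hTA : T ∈ F.A := F.mem_A_of_subset hST hSA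
    simp [hSA, hTA]
  by_cases hS0 : S ∈ F.V 0
  · have hT0 : T ∈ F.V 0 := F.mem_V_of_subset hST hS0
    by_cases hTA : T ∈ F.A
    · simp [hTA]
    · simp [hSA, hS0, hTA, hT0]
  by_cases hS1 : S ∈ F.V 1
  · have hT1 : T ∈ F.V 1 := F.mem_V_of_subset hST hS1
    by_cases hTA : T ∈ F.A
    · simp [hTA]
    · have hT0 : T ∉ F.V 0 := fun h => hTA (F.mem_A_of_mem_mem (by decide) h hT1)
      simp [hSA, hS0, hS1, hTA, hT0, hT1]
  by_cases hS2 : S ∈ F.V 2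
  · have hT2 : T ∈ F.V 2 := F.mem_V_of_subset hST hS2
    by_cases hTA : T ∈ F.A
    · simp [hTA]
    · have hT0 : T ∉ F.V 0 := fun h => hTA (F.mem_A_of_mem_mem (by decide) h hT2)
      have hT1 : T ∉ F.V 1 := fun h => hTA (by
        have := F.mem_A_of_mem_mem (i := 1) (j := 2) (by decide) h hT2
        exact this)
      simp [hSA, hS0, hS1, hS2, hTA, hT0, hT1, hT2]
  · simp [hSA, hS0, hS1, hS2]

/-! ## The antipodal sum and its nonnegativity -/

omit [DecidableEq α] in
/-- `insert e W ∖ insert e S = W ∖ S` for `e ∉ W`. [folklore] -/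
theorem insert_sdiff_insert_of_not_mem [DecidableEq α] {e : α} {W S : Finset α} (he : e ∉ W) :
    insert e W \ insert e S = W \ S := by
  ext x
  simp only [mem_sdiff, mem_insert, not_or]
  constructor
  · rintro ⟨h1 | h1, h2, h3⟩
    · exact absurd h1 h2
    · exact ⟨h1, h3⟩
  · rintro ⟨h1, h2⟩
    exact ⟨Or.inr h1, fun h => he (h ▸ h1), h2⟩

omit [DecidableEq α] in
/-- Moving the exposed coordinate `e` from the complement block into the offset. [folklore] -/
theorem union_insert_sdiff [DecidableEq α] {e : α} {W S G : Finset α} (hS : e ∉ S) :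
    G ∪ (insert e W \ S) = insert e G ∪ (W \ S) := by
  ext x
  simp only [mem_union, mem_sdiff, mem_insert]
  constructor
  · rintro (h | ⟨h1 | h1, h2⟩)
    · exact Or.inl (Or.inr h)
    · exact Or.inl (Or.inl h1)
    · exact Or.inr ⟨h1, h2⟩
  · rintro ((h | h) | ⟨h1, h2⟩)
    · exact Or.inr ⟨Or.inl h, fun hx => hS (h ▸ hx)⟩
    · exact Or.inl h
    · exact Or.inr ⟨Or.inr h1, h2⟩

omit [DecidableEq α] in
/-- `G ∪ insert e S = insert e G ∪ S`. [folklore] -/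
theorem union_insert_eq [DecidableEq α] (e : α) (G S : Finset α) : G ∪ insert e S = insert e G ∪ S := by
  ext x; simp only [mem_union, mem_insert]; tauto

/-- **Antipodal Gladkov with offsets** (this work): for `G₂ ⊆ G₁`,
`0 ≤ Σ_{S ⊆ W} kk (lab (G₁ ∪ S)) (lab (G₂ ∪ (W ∖ S)))`. [this work] -/
theorem antipodal_sum_nonneg (W : Finset α) :
    ∀ G₁ G₂ : Finset α, G₂ ⊆ G₁ →
      0 ≤ ∑ S ∈ W.powerset, kk (F.lab (G₁ ∪ S)) (F.lab (G₂ ∪ (W \ S))) := by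
  induction W using Finset.induction_on with
  | empty =>
    intro G₁ G₂ h
    simp only [powerset_empty, sum_singleton, union_empty, sdiff_self, bot_eq_empty]
    exact kk_nonneg_of_mle _ _ (F.lab_mono h)
  | insert e W' he ih =>
    intro G₁ G₂ h
    rw [sum_powerset_insert he]
    have key : ∀ S ∈ W'.powerset,
        kk (F.lab (G₁ ∪ S)) (F.lab (G₂ ∪ (W' \ S))) + kk (F.lab (insert e G₁ ∪ S)) (F.lab (insert e G₂ ∪ (W' \ S)))
          ≤ kk (F.lab (G₁ ∪ S)) (F.lab (G₂ ∪ (insert e W' \ S)))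
            + kk (F.lab (G₁ ∪ insert e S)) (F.lab (G₂ ∪ (insert e W' \ insert e S))) := by
      intro S hS
      have hSW : S ⊆ W' := mem_powerset.1 hS
      have heS : e ∉ S := fun hx => he (hSW hx)
      rw [union_insert_sdiff heS, insert_sdiff_insert_of_not_mem he, union_insert_eq]
      have h1 :=
        F.lab_mono (union_subset_union (subset_insert e G₁) (subset_refl S))
      have h2 :=
        F.lab_mono (union_subset_union (subset_insert e G₂) (subset_refl (W' \ S)))
      have := kk_submod _ _ _ _ h1 h2
      linarith
    have hsum := sum_le_sum key
    rw [sum_add_distrib, sum_add_distrib] at hsum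
    have ih1 := ih G₁ G₂ h
    have ih2 := ih (insert e G₁) (insert e G₂) (insert_subset_insert e h)
    linarith

/-- **Antipodal Gladkov** (this work): `0 ≤ Σ_{S ⊆ W} kk (lab S) (lab (W ∖ S))` — the two-copy fibre form of
`ab − e₂(c) ≥ 0` for every monotone map to `M₃`. [this work] -/
theorem antipodal_gladkov (W : Finset α) : 0 ≤ ∑ S ∈ W.powerset, kk (F.lab S) (F.lab (W \ S)) := by
  have h := F.antipodal_sum_nonneg W ∅ ∅ subset_rfl
  simpa only [empty_union] using h

/-- **Polarised antipodal Gladkov** for a comparable pair of sections (`G₂ ⊆ G₁`). [this work] -/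
theorem antipodal_gladkov_polarized (W G₁ G₂ : Finset α) (h : G₂ ⊆ G₁) :
    0 ≤ ∑ S ∈ W.powerset, kk (F.lab (G₁ ∪ S)) (F.lab (G₂ ∪ (W \ S))) :=
  F.antipodal_sum_nonneg W G₁ G₂ h

/-- Counting form: on every sub-cube `2^W`, the antipodal pairs `(S, W ∖ S)` labelled by two DISTINCT petals are at most as many as
those labelled {top, bottom} (in either order). [this work] -/
theorem card_distinctPetals_le (W : Finset α) :
    #(W.powerset.filter fun S => F.lab S ≠ 0 ∧ F.lab S ≠ 4 ∧ F.lab (W \ S) ≠ 0 ∧ F.lab (W \ S) ≠ 4 ∧ F.lab S ≠ F.lab (W \ S))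
      ≤ #(W.powerset.filter fun S => F.lab S = 4 ∧ F.lab (W \ S) = 0)
        + #(W.powerset.filter fun S => F.lab S = 0 ∧ F.lab (W \ S) = 4) := by
  have h := F.antipodal_gladkov W
  simp only [kk_eq_ite, sum_sub_distrib, sum_add_distrib, sum_boole] at h
  omega

end Sunflower

end Summit.CriticalPhenomena.PercolationContinuityZ3.Theorems.SunflowerPartition
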